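import Mathlib
import HarnessLib
import Summits.Parity.GeneralizedHardyLittlewood.Theorems.LeeYangFibresHyperbolicityClipsParityFibreAlgebra

/-!
# Crux `FibreHyperbolicity` (stmt-Parity-14108), line `SketchIdeator1` (model transfer): the fibre coefficient bound

Support file for the line skeleton `Cruxes/FibreHyperbolicity` (namespace `…ModelTransfer`): the stub
`stub_coeffBound` (`CoeffBound`, unfolded), a pure finite-algebra inequality over `ℝ`.

On the box `[1,u]^t` of cell indices `j`, suppose the cells `C_j` follow the independent model with
relative accuracy `ε`:
`|C_j − Λ ∏_k I(j_k)| ≤ ε Λ ∏_{k : j_k < u} I(j_k)` (`I ≥ 0`, `I(1) = 1`).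
Fix a coordinate `i`, fugacities `0 < w_k ≤ 1` and put `F(w) = ∑_{n=1}^u I(n) w^n`,
`Λ' = Λ ∏_{k ≠ i} F(w_k)`. Then the `m`-th fibre coefficient
`p_m = ∑_{j_i = m} C_j ∏_{k ≠ i} w_k^{j_k}` satisfies
`|p_m − Λ' I(m)| ≤ 2^{t-1} ε Λ' (I(m) + [m = u])`.

Proof: the main term `∑_{j_i = m} Λ ∏_k I(j_k) ∏_{k ≠ i} w_k^{j_k}` equals `Λ' I(m)` by the sum–product
interchange `HyperbolicityClipsParity.sum_filter_piFinset_prod`; the error is at most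
`ε Λ ∑_{j_i = m} ∏_k [j_k < u ? I(j_k) : 1] ∏_{k ≠ i} w_k^{j_k} = ε Λ c_m ∏_{k ≠ i} (∑_n [n < u ? I(n) : 1] w_k^n)`
with `c_m = I(m)` (`m < u`) or `1` (`m = u`), and each factor is `≤ F(w_k) + w_k^u ≤ 2 F(w_k)` because
`w_k^u ≤ w_k = I(1) w_k ≤ F(w_k)`.
-/

namespace Summit.Parity.GeneralizedHardyLittlewood.Cruxes.FibreHyperbolicity.ModelTransfer

open Finset
open scoped BigOperators Classical
open Summit.Parity.GeneralizedHardyLittlewood.Theorems.HyperbolicityClipsParity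
  (sum_filter_piFinset_prod)

/-- The model sum on a fibre factorises:
`∑_{j ∈ [1,u]^t, j_i = m} (∏_k a(j_k)) ∏_{k ≠ i} w_k^{j_k} = a(m) ∏_{k ≠ i} ∑_{n=1}^u a(n) w_k^n`. -/
private theorem fibre_modelSum {t u : ℕ} (i : Fin t) {m : ℕ} (hm : m ∈ Finset.Icc 1 u)
    (a : ℕ → ℝ) (w : Fin t → ℝ) :
    ∑ j ∈ (Fintype.piFinset fun _ : Fin t => Finset.Icc 1 u).filter (fun j => j i = m),
        (∏ k, a (j k)) * ∏ k ∈ Finset.univ.erase i, w k ^ (j k) =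
      a m * ∏ k ∈ Finset.univ.erase i, ∑ n ∈ Finset.Icc 1 u, a n * w k ^ n := by
  let f : Fin t → ℕ → ℝ := fun k n => a n * (if k = i then 1 else w k ^ n)
  have key := sum_filter_piFinset_prod (fun _ : Fin t => Finset.Icc 1 u) i hm f
  have hfi : f i m = a m := by simp [f]
  have hfk : ∀ k ∈ Finset.univ.erase i, ∀ n, f k n = a n * w k ^ n := by
    intro k hk n
    simp [f, Finset.ne_of_mem_erase hk]
  have hprod : ∀ j : Fin t → ℕ,
      ∏ k, f k (j k) = (∏ k, a (j k)) * ∏ k ∈ Finset.univ.erase i, w k ^ (j k) := by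
    intro j
    simp only [f, Finset.prod_mul_distrib]
    congr 1
    rw [← Finset.mul_prod_erase Finset.univ _ (Finset.mem_univ i), if_pos rfl, one_mul]
    exact Finset.prod_congr rfl fun k hk => if_neg (Finset.ne_of_mem_erase hk)
  rw [hfi, Finset.prod_congr rfl fun k hk => Finset.sum_congr rfl fun n _ => hfk k hk n] at key
  rw [← key]
  exact Finset.sum_congr rfl fun j _ => (hprod j).symm

/-- **Fibre coefficient bound** (`CoeffBound`, stub `stub_coeffBound` of the model-transfer line):
a cell law `|C_j − Λ ∏_k I(j_k)| ≤ ε Λ ∏_{k : j_k < u} I(j_k)` on `[1,u]^t` forces, for every coordinate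
`i`, fugacities `0 < w_k ≤ 1` and `m ∈ [1,u]`,
`|∑_{j_i = m} C_j ∏_{k ≠ i} w_k^{j_k} − Λ' I(m)| ≤ 2^{t-1} ε Λ' (I(m) + [m = u])`,
`Λ' = Λ ∏_{k ≠ i} ∑_{n=1}^u I(n) w_k^n`. (The hypotheses `2 ≤ u` and `I u = 0` are not needed.) -/
theorem stub_coeffBound :
    ∀ (t u : ℕ), 2 ≤ u → ∀ (i : Fin t) (C : (Fin t → ℕ) → ℝ) (I : ℕ → ℝ) (Λ ε : ℝ) (w : Fin t → ℝ),
      (∀ n, 0 ≤ I n) → I 1 = 1 → I u = 0 → 0 ≤ Λ → 0 ≤ ε → (∀ k, 0 < w k ∧ w k ≤ 1) →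
      (∀ j ∈ Fintype.piFinset (fun _ : Fin t => Finset.Icc 1 u),
        |C j - Λ * ∏ k, I (j k)| ≤ ε * Λ * ∏ k ∈ Finset.univ.filter (fun k => j k < u), I (j k)) →
      ∀ m ∈ Finset.Icc 1 u,
        |(∑ j ∈ (Fintype.piFinset (fun _ : Fin t => Finset.Icc 1 u)).filter (fun j => j i = m),
            C j * ∏ k ∈ Finset.univ.erase i, w k ^ (j k)) -
          (Λ * ∏ k ∈ Finset.univ.erase i, ∑ n ∈ Finset.Icc 1 u, I n * w k ^ n) * I m| ≤
        2 ^ (t - 1) * ε * (Λ * ∏ k ∈ Finset.univ.erase i, ∑ n ∈ Finset.Icc 1 u, I n * w k ^ n) *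
          (I m + if m = u then 1 else 0) := by
  intro t u _hu i C I Λ ε w hI0 hI1 _hIu hΛ hε hw hC m hm
  have hu1 : 1 ≤ u := (Finset.mem_Icc.1 hm).1.trans (Finset.mem_Icc.1 hm).2
  -- Abbreviations.
  set box : Finset (Fin t → ℕ) := Fintype.piFinset (fun _ : Fin t => Finset.Icc 1 u) with hbox
  set P : ℝ := ∏ k ∈ Finset.univ.erase i, ∑ n ∈ Finset.Icc 1 u, I n * w k ^ n with hP
  -- Signs.
  have hWnn : ∀ j : Fin t → ℕ, 0 ≤ ∏ k ∈ Finset.univ.erase i, w k ^ (j k) :=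
    fun j => Finset.prod_nonneg fun k _ => pow_nonneg (hw k).1.le _
  have hFnn : ∀ k, 0 ≤ ∑ n ∈ Finset.Icc 1 u, I n * w k ^ n :=
    fun k => Finset.sum_nonneg fun n _ => mul_nonneg (hI0 n) (pow_nonneg (hw k).1.le n)
  have hPnn : 0 ≤ P := Finset.prod_nonneg fun k _ => hFnn k
  have hcnn : ∀ n, 0 ≤ (if n < u then I n else (1 : ℝ)) := fun n => by
    split_ifs
    · exact hI0 n
    · exact zero_le_one
  -- Step 1: the main term `∑_{j_i = m} Λ ∏_k I(j_k) ∏_{k ≠ i} w_k^{j_k} = Λ P I(m)`.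
  have hmain : ∑ j ∈ box.filter (fun j => j i = m),
      (Λ * ∏ k, I (j k)) * ∏ k ∈ Finset.univ.erase i, w k ^ (j k) = Λ * P * I m := by
    have h := fibre_modelSum i hm I w
    rw [← hbox] at h
    calc ∑ j ∈ box.filter (fun j => j i = m),
          (Λ * ∏ k, I (j k)) * ∏ k ∈ Finset.univ.erase i, w k ^ (j k)
        = Λ * ∑ j ∈ box.filter (fun j => j i = m),
            (∏ k, I (j k)) * ∏ k ∈ Finset.univ.erase i, w k ^ (j k) := by
          rw [Finset.mul_sum]
          exact Finset.sum_congr rfl fun j _ => by ring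
      _ = Λ * P * I m := by rw [h, hP]; ring
  -- Step 2: the difference is the weighted sum of the cell-law errors.
  have hdiff : (∑ j ∈ box.filter (fun j => j i = m),
      C j * ∏ k ∈ Finset.univ.erase i, w k ^ (j k)) - Λ * P * I m =
      ∑ j ∈ box.filter (fun j => j i = m),
        (C j - Λ * ∏ k, I (j k)) * ∏ k ∈ Finset.univ.erase i, w k ^ (j k) := by
    rw [← hmain, ← Finset.sum_sub_distrib]
    exact Finset.sum_congr rfl fun j _ => by ring
  -- Step 3: termwise bound from the cell law (`∏_{k : j_k < u} I(j_k) = ∏_k [j_k < u ? I(j_k) : 1]`).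
  have hterm : ∀ j ∈ box.filter (fun j => j i = m),
      |(C j - Λ * ∏ k, I (j k)) * ∏ k ∈ Finset.univ.erase i, w k ^ (j k)| ≤
        ε * Λ * ((∏ k, (if j k < u then I (j k) else 1)) *
          ∏ k ∈ Finset.univ.erase i, w k ^ (j k)) := by
    intro j hj
    have hjb : j ∈ box := (Finset.mem_filter.1 hj).1
    have hCj := hC j hjb
    rw [Finset.prod_filter] at hCj
    rw [abs_mul, abs_of_nonneg (hWnn j)]
    calc |C j - Λ * ∏ k, I (j k)| * ∏ k ∈ Finset.univ.erase i, w k ^ (j k)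
        ≤ (ε * Λ * ∏ k, (if j k < u then I (j k) else 1)) *
            ∏ k ∈ Finset.univ.erase i, w k ^ (j k) := mul_le_mul_of_nonneg_right hCj (hWnn j)
      _ = _ := by ring
  -- Step 4: the error sum factorises as well.
  have herr : ∑ j ∈ box.filter (fun j => j i = m),
      (∏ k, (if j k < u then I (j k) else 1)) * ∏ k ∈ Finset.univ.erase i, w k ^ (j k) =
      (if m < u then I m else 1) * ∏ k ∈ Finset.univ.erase i,
        ∑ n ∈ Finset.Icc 1 u, (if n < u then I n else 1) * w k ^ n := by
    have h := fibre_modelSum i hm (fun n => if n < u then I n else 1) w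
    rw [← hbox] at h
    exact h
  -- Step 5: each factor is at most `2 F(w_k)`.
  have hfac : ∀ k, ∑ n ∈ Finset.Icc 1 u, (if n < u then I n else 1) * w k ^ n ≤
      2 * ∑ n ∈ Finset.Icc 1 u, I n * w k ^ n := by
    intro k
    have hw0 : 0 ≤ w k := (hw k).1.le
    have hwu : w k ^ u ≤ ∑ n ∈ Finset.Icc 1 u, I n * w k ^ n := by
      have h1 : (1 : ℕ) ∈ Finset.Icc 1 u := Finset.mem_Icc.2 ⟨le_rfl, hu1⟩
      have hs := Finset.single_le_sum (f := fun n => I n * w k ^ n)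
        (fun n _ => mul_nonneg (hI0 n) (pow_nonneg hw0 n)) h1
      simp only [hI1, one_mul, pow_one] at hs
      exact (pow_le_of_le_one hw0 (hw k).2 (by omega : u ≠ 0)).trans hs
    have hle : ∑ n ∈ Finset.Icc 1 u, (if n < u then I n else 1) * w k ^ n ≤
        ∑ n ∈ Finset.Icc 1 u, (I n * w k ^ n + if n = u then w k ^ n else 0) := by
      refine Finset.sum_le_sum fun n hn => ?_
      by_cases hnu : n < u
      · rw [if_pos hnu, if_neg hnu.ne, add_zero]
      · have hn' : n = u := le_antisymm (Finset.mem_Icc.1 hn).2 (not_lt.1 hnu)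
        rw [if_neg hnu, if_pos hn', one_mul]
        nlinarith [hI0 n, pow_nonneg hw0 n]
    rw [Finset.sum_add_distrib, Finset.sum_ite_eq' (Finset.Icc 1 u) u,
      if_pos (Finset.mem_Icc.2 ⟨hu1, le_rfl⟩)] at hle
    linarith
  -- Step 6: the product of the factors is at most `2^{t-1} P`.
  have hprodle : ∏ k ∈ Finset.univ.erase i,
      ∑ n ∈ Finset.Icc 1 u, (if n < u then I n else 1) * w k ^ n ≤ 2 ^ (t - 1) * P := by
    have hcard : (Finset.univ.erase i).card = t - 1 := by
      rw [Finset.card_erase_of_mem (Finset.mem_univ i), Finset.card_univ, Fintype.card_fin]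
    calc ∏ k ∈ Finset.univ.erase i, ∑ n ∈ Finset.Icc 1 u, (if n < u then I n else 1) * w k ^ n
        ≤ ∏ k ∈ Finset.univ.erase i, 2 * ∑ n ∈ Finset.Icc 1 u, I n * w k ^ n :=
          Finset.prod_le_prod
            (fun k _ => Finset.sum_nonneg fun n _ =>
              mul_nonneg (hcnn n) (pow_nonneg (hw k).1.le n))
            fun k _ => hfac k
      _ = 2 ^ (t - 1) * P := by
          rw [Finset.prod_mul_distrib, Finset.prod_const, hcard, hP]
  -- Step 7: `c_m ≤ I(m) + [m = u]`.
  have hmI : (if m < u then I m else 1) ≤ I m + if m = u then 1 else 0 := by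
    by_cases hmu : m < u
    · rw [if_pos hmu, if_neg hmu.ne, add_zero]
    · have hm' : m = u := le_antisymm (Finset.mem_Icc.1 hm).2 (not_lt.1 hmu)
      rw [if_neg hmu, if_pos hm']
      linarith [hI0 m]
  -- Assembly.
  rw [hdiff]
  calc |∑ j ∈ box.filter (fun j => j i = m),
        (C j - Λ * ∏ k, I (j k)) * ∏ k ∈ Finset.univ.erase i, w k ^ (j k)|
      ≤ ∑ j ∈ box.filter (fun j => j i = m),
          |(C j - Λ * ∏ k, I (j k)) * ∏ k ∈ Finset.univ.erase i, w k ^ (j k)| :=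
        Finset.abs_sum_le_sum_abs _ _
    _ ≤ ∑ j ∈ box.filter (fun j => j i = m), ε * Λ *
          ((∏ k, (if j k < u then I (j k) else 1)) * ∏ k ∈ Finset.univ.erase i, w k ^ (j k)) :=
        Finset.sum_le_sum hterm
    _ = ε * Λ * ((if m < u then I m else 1) * ∏ k ∈ Finset.univ.erase i,
          ∑ n ∈ Finset.Icc 1 u, (if n < u then I n else 1) * w k ^ n) := by
        rw [← Finset.mul_sum, herr]
    _ ≤ ε * Λ * ((if m < u then I m else 1) * (2 ^ (t - 1) * P)) :=
        mul_le_mul_of_nonneg_left (mul_le_mul_of_nonneg_left hprodle (hcnn m)) (mul_nonneg hε hΛ)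
    _ ≤ ε * Λ * ((I m + if m = u then 1 else 0) * (2 ^ (t - 1) * P)) :=
        mul_le_mul_of_nonneg_left
          (mul_le_mul_of_nonneg_right hmI (mul_nonneg (pow_nonneg zero_le_two _) hPnn))
          (mul_nonneg hε hΛ)
    _ = 2 ^ (t - 1) * ε * (Λ * P) * (I m + if m = u then 1 else 0) := by ring

end Summit.Parity.GeneralizedHardyLittlewood.Cruxes.FibreHyperbolicity.ModelTransfer
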